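import Summits.CriticalPhenomena.SAWScalingLimit.Theses.SAWStochasticQuantisation
import Literature.Probability.RandomPlanarGeometry.BFACFDynamics
import Literature.Probability.RandomPlanarGeometry.HexSAW
import Literature.Probability.RandomPlanarGeometry.SLEUniquenessInLaw

/-!
# Line `birth` — registered skeleton (BC3) for the crux `SLEAnnihilated` (stmt-CriticalPhenomena-7765)

Crux (FIXED; rank 3 of `route-CriticalPhenomena-SAWStochasticQuantisation`, decl
`Summit.CriticalPhenomena.SAWScalingLimit.Theses.SAWStochasticQuantisation.SLEAnnihilated`): for every Dobrushin
domain `D`, every `ℤ²` endpoint approximation `(a_δ, b_δ)` and every pair `(F, G)` with `G` bounded continuous on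
`CurveClass ℂ` that is a `δ^(-8/3)`-GRAPH-LIMIT PAIR of the critical Metropolis BFACF generators (lattice
correctors `f_δ` uniformly `o(1)`-close to `F ∘ curve`, `δ^(-8/3) L_δ f_δ → G ∘ curve` in `L¹(P_δ)`), every chordal
SLE(8/3) law `μ` in `(D; a, b)` satisfies `∫ G dμ = 0` ("SLE(8/3) is annihilated by the diffusive Stein limit").
Skeleton registrar planner-skel-stmt-CriticalPhenomena-7765-0, 2026-08-17; tree path
`Summits/CriticalPhenomena/SAWScalingLimit/Cruxes/SLEAnnihilated/Lines/birth.lean`.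

## The line = the route header's own TWO-LAYER PLAN for this crux, typed:
## "SLEAnnihilated ⇐ GeneratorUniversalityHex → HexConjecture → SLEAnnihilated; glue = hexagonal ExactStationarity +
## the Echeverría step on Hex + weak convergence"

The identity family `∫ G dμ_SLE = 0` is reached from the HONEYCOMB lattice, where the scaling limit is Duminil-Copin–
Smirnov's Conjecture 1 (the tree's registered open statement `SAW.HexSAWScalingLimit`, verbatim the shared route item
`SAWHexUniversality.HexConjecture`, stmt-CriticalPhenomena-0808) and where the critical law `hexSAWLaw ∝ x_c^{ℓ(γ)}`,
`x_c = 1/√(2+√2)`, is again EXACTLY stationary for a local length-changing Metropolis dynamics — the HEXAGON-FLIP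
chain (vertex-list windows `p·y·s·z·q ↦ p·y·s'·z·q`, `s ≠ s'`, `|s| + |s'| = 4`: the two arcs `y → z` of one hexagon,
`Δlength ∈ {0, ±2, ±4}`, rates `min(1, x_c^{Δlength})`; the honeycomb analogue of `SAW.bfacfGenerator`, written out
inline as a `finsum` exactly as the route inlines the `ℤ²` generator).

* S1 `stub_hexGeneratorUniversality` (OPEN; the load-bearing stub): GENERATOR UNIVERSALITY — there is a lattice
  conversion constant `c > 0` such that every `δ^(-8/3)`-graph-limit pair `(F, G)` of the `ℤ²` BFACF generators is,
  along SOME honeycomb endpoint approximation `(a'_δ, b'_δ)` of the same Dobrushin domain, a graph-limit pair of the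
  `c·δ^(-8/3)`-rescaled hexagon-flip generators: hex correctors `f'_δ` uniformly `o(1)`-close to `F ∘ curve` with
  `c δ^(-8/3) L^hex_δ f'_δ → G ∘ curve` in `L¹(hexSAWLaw)`. Why plausibly true: both chains are reversible local
  area-exchange dynamics of the same universality class whose slow mode is the signed area (relaxation `∝ ⟨N⟩^{4ν}`
  moves, ν = 3/4 on both lattices); the macroscopic mobility is a symmetric 2-tensor, hence SCALAR under the 4-fold
  (`ℤ²`) and 6-fold (`ℍ`) lattice symmetries, so the continuum pregenerators can differ at most by the scalar `c`
  (lattice spacing of `hexCenter`, `x_c`, flip multiplicities). Why it might fail (route header): tangential mobility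
  along a lattice-direction-dependent microstructure need not homogenise to a scalar at the generator level even if
  the LAWS are universal (Beffara2008Universal-type direction dependence); and it presupposes non-trivial pairs exist.
* S2 `stub_hexStationaryNull` (PROVABLE NOW, size M): the honeycomb ECHEVERRÍA STEP — if `G ∘ curve` is the
  `L¹(hexSAWLaw)`-limit of `c·δ^(-8/3) L^hex_δ f'_δ` then `E^hex_δ[G ∘ curve] → 0` as `δ → 0⁺`, because
  `∫ L^hex_δ g dP^hex_δ = 0` EXACTLY for every `g` and every `δ > 0` (detailed balance:
  `x_c^{ℓ(γ)} min(1, x_c^{ℓ(γ')−ℓ(γ)}) = x_c · min(x_c^{|γ|}, x_c^{|γ'|})` is symmetric and the window relation is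
  symmetric; `HexDomainSAW Ω δ u v` is finite for bounded `Ω`, `δ > 0`, so `finsum`/`∫` are finite sums and every
  function is integrable; if no SAW joins the endpoints the law is `0` and everything vanishes). No continuity,
  boundedness or endpoint-approximation hypothesis is needed, and none is assumed. Tools: `finsum_eq_sum_of_fintype`,
  `Finset.sum_comm`, `MeasureTheory.integral_fintype`/`integral_smul_measure`, `SAW.embWeight_singleton`,
  `SAW.hexCriticalFugacity_pos_lt_one`, `tendsto_of_tendsto_of_tendsto_of_le_of_le` / `squeeze_zero_norm`.
* Third hypothesis, BY NAME (a registered obligation, deliberately NOT a stub of this line): `SAW.HexSAWScalingLimit`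
  (`@[conjecture]`, DuminilCopinSmirnov2012 Conj. 1 = item stmt-CriticalPhenomena-0808 of route SAWHexUniversality).

`SLEAnnihilated_of` (kernel-checked, no `sorry` of its own, ≈ 20 lines) is NOT a conjunction seam: given a `ℤ²` pair
`(F, G)` it runs S1 to get a hex approximation `(a', b')` and a hex pair, S2 to get `E^hex_δ[G ∘ curve] → 0`, the
conjecture to get an SLE(8/3) random curve `Γ` with `TendstoLaw` of the hex curves, evaluates `TendstoLaw` at `G`
packaged as a `BoundedContinuousFunction` (`ofNormedAddCommGroup`), identifies the two limits along the proper filter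
`𝓝[>] 0` (`tendsto_nhds_unique`): `∫ G ∘ Γ d(preWiener) = 0`, and transports to the arbitrary SLE(8/3) law `μ` by
UNIQUENESS OF THE SLE LAW (`IsSLELaw.unique'`, proved in tree from `IsSLECurve.map_eq_holds`) and `integral_map`.
The `ℤ²` pair hypothesis of the crux (inlined generator) is fed to S1 (stated with the tree's `SAW.bfacfGenerator`)
by definitional unfolding — certifying in passing that `BFACFDynamics.lean` IS the route's inlined prelude.

Negatives / disproof honoured: no `Disproof.lean` and no other workfile exists for this crux (`ledger crux ls
stmt-CriticalPhenomena-7765`, 2026-08-17); `ledger negatives --problem CriticalPhenomena` (11 entries, 2026-08-17): none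
concerns lattice dynamics, generators, stationarity or generator universality (the hex-side negative stmt-5420 is a
parafermionic-observable limit, a different object; stmt-0772 is the all-δ tightness, not used here). Barriers (route
header): `SAWNotKineticallyGrown` — not engaged (equilibrium dynamics at fixed endpoints, no growth rule);
`EmbeddingModulusUniqueness` — respected: conformal information enters only through the honeycomb conjecture, and S1
claims a SCALAR conversion constant, which is exactly what 4-fold or 6-fold symmetry permits for a 2-tensor, no more;
`PlanarEdwardsModelDiffusive` — not in class (strict self-avoidance is a hard constraint of both state spaces);
`ParafermionicHalfCauchyRiemann` — bites only the third hypothesis (DCS Conj. 1), which this line imports by name and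
does not claim to advance.

BC3 AUDIT (registrar, 2026-08-17, `lean check --json` on this file): rc 0, errors [], sorries 2 = the two `stub_*`
declarations (`stub_hexGeneratorUniversality`, `stub_hexStationaryNull`; the only `declaration uses sorry` warnings),
zero elsewhere; advisory audit: `SLEAnnihilated_of` class `proof.conditional`, target
`Summit.CriticalPhenomena.SAWScalingLimit.Theses.SAWStochasticQuantisation.SLEAnnihilated` (the route decl BY NAME) under
the hypotheses `__Registered.stub_hexGeneratorUniversality`, `__Registered.stub_hexStationaryNull` (name-keyed aliases,
device of `Cruxes/InteriorRegularity/Lines/birth.lean`) and the registered conjecture `SAW.HexSAWScalingLimit`; no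
`sorryAx` in its own closure modulo the hypotheses.
BC3 PROBES (registrar folder `bc/probe_<Def>_{crux,summit}.lean`, `set_option maxHeartbeats 400000`, the combined
`first | exact? | simpa [Def] | (unfold Def; simpa) | aesop` AND the alternatives one by one, since a heartbeat
time-out inside `first` is not caught): 20/20 FAIL for Def ∈ {HexGeneratorUniversality, HexStationaryNull} against
BOTH `SLEAnnihilated` and `_root_.SAWScalingLimit` — combined = deterministic time-out at `whnf`
(HexGeneratorUniversality) / unsolved goal after aesop's exhaustive search (HexStationaryNull); `exact?` = "could not
close the goal"; `simpa [Def]` and `unfold Def; simpa` = "Tactic `assumption` failed" with the unfolded implication as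
residual goal; `aesop` = "failed to prove the goal after exhaustive search". Extra probe `bc/probe_HexSAWScalingLimit_both.lean`:
the named conjecture hypothesis closes neither the crux nor the summit either (7/7 FAIL). No stub is cheaply the crux
or the summit.
-/

noncomputable section

open scoped Classical NNReal
open Filter Topology Set MeasureTheory
open Literature.Probability Literature.Probability.RandomPlanarGeometry Literature.Probability.LatticeModels

namespace Summit.CriticalPhenomena.SAWScalingLimit.Cruxes.SLEAnnihilated.Birth

/-! ### Vocabulary of the line: the two new pieces as named statements -/

/-- **S1, named.** Hexagonal GENERATOR UNIVERSALITY of the diffusively rescaled critical BFACF dynamics: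
there is a lattice-conversion constant `c > 0` such that every `δ^(-8/3)`-graph-limit pair `(F, G)` of the
square-lattice Metropolis BFACF generators at `x_c(ℤ²)` (correctors `f_δ` uniformly `o(1)`-close to `F`,
`δ^(-8/3) L_δ f_δ → G` in `L¹` of the critical law) is, along SOME honeycomb endpoint approximation of the
same Dobrushin domain, a graph-limit pair `(F, G)` of the `c·δ^(-8/3)`-rescaled HEXAGON-FLIP Metropolis
generators of the critical honeycomb SAW (`x_c(ℍ) = 1/√(2+√2)`, law `hexSAWLaw ∝ x_c^{ℓ(γ)}`): hexagon flips =
vertex-list windows `p·y·s·z·q ↦ p·y·s'·z·q`, `s ≠ s'`, `|s| + |s'| = 4` (the two arcs of one hexagon). -/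
def HexGeneratorUniversality : Prop :=
  let hexGen : ∀ (Ω : Set ℂ) (δ : ℝ) (u v : HexVertex), (SAW.HexDomainSAW Ω δ u v → ℝ) →
      SAW.HexDomainSAW Ω δ u v → ℝ := fun Ω δ u v g γ =>
    ∑ᶠ γ' : SAW.HexDomainSAW Ω δ u v,
      (if (∃ (p q s s' : List HexVertex) (y z : HexVertex),
          γ.walk.support = p ++ y :: (s ++ z :: q) ∧ γ'.walk.support = p ++ y :: (s' ++ z :: q) ∧
            s ≠ s' ∧ s.length + s'.length = 4)
        then min 1 (SAW.hexCriticalFugacity ^ ((γ'.length : ℤ) - (γ.length : ℤ))) * (g γ' - g γ) else 0);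
  ∃ c : ℝ, 0 < c ∧ ∀ (D : DobrushinDomain) (a b : ℝ → Site 2), SAW.IsEndpointApprox D a b →
    ∀ F G : CurveClass ℂ → ℝ, Continuous G → (∃ C : ℝ, ∀ x, |G x| ≤ C) →
    (∃ f : ∀ δ : ℝ, SAW.DomainSAW D.carrier δ (a δ) (b δ) → ℝ,
      (∀ ε : ℝ, 0 < ε → ∀ᶠ δ in 𝓝[>] (0 : ℝ),
        ∀ γ : SAW.DomainSAW D.carrier δ (a δ) (b δ), |f δ γ - F γ.curve| ≤ ε) ∧
      Tendsto (fun δ : ℝ => ∫ γ, |δ ^ (-(8 : ℝ) / 3) *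
          SAW.bfacfGenerator SAW.criticalFugacity (f δ) γ - G γ.curve| ∂(SAW.law D.carrier δ (a δ) (b δ)))
        (𝓝[>] (0 : ℝ)) (𝓝 0)) →
    ∃ (a' b' : ℝ → HexVertex), SAW.IsEmbEndpointApprox hexGraph hexCenter D a' b' ∧
      ∃ f' : ∀ δ : ℝ, SAW.HexDomainSAW D.carrier δ (a' δ) (b' δ) → ℝ,
        (∀ ε : ℝ, 0 < ε → ∀ᶠ δ in 𝓝[>] (0 : ℝ),
          ∀ γ : SAW.HexDomainSAW D.carrier δ (a' δ) (b' δ), |f' δ γ - F γ.curve| ≤ ε) ∧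
        Tendsto (fun δ : ℝ => ∫ γ, |c * δ ^ (-(8 : ℝ) / 3) *
            hexGen D.carrier δ (a' δ) (b' δ) (f' δ) γ - G γ.curve| ∂(SAW.hexSAWLaw D.carrier δ (a' δ) (b' δ)))
          (𝓝[>] (0 : ℝ)) (𝓝 0)

/-- **S2, named.** EXACT STATIONARITY OF THE CRITICAL HONEYCOMB LAW ⇒ HEX-NULL OBSERVABLES: if a continuum
observable `G` is the `L¹(hexSAWLaw)`-limit of `c·δ^(-8/3)`-rescaled hexagon-flip generators applied to some
lattice functions `f'_δ`, then `E^hex_δ[G ∘ curve] → 0` as `δ → 0⁺` — because `∫ L^hex_δ g dP^hex_δ = 0` EXACTLY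
at every mesh (detailed balance: `x_c^{ℓ(γ)} min(1, x_c^{ℓ(γ')−ℓ(γ)})` is symmetric; finitely many SAWs in a
bounded domain). The honeycomb Echeverría step; no approximation hypothesis on the endpoints is needed. -/
def HexStationaryNull : Prop :=
  let hexGen : ∀ (Ω : Set ℂ) (δ : ℝ) (u v : HexVertex), (SAW.HexDomainSAW Ω δ u v → ℝ) →
      SAW.HexDomainSAW Ω δ u v → ℝ := fun Ω δ u v g γ =>
    ∑ᶠ γ' : SAW.HexDomainSAW Ω δ u v,
      (if (∃ (p q s s' : List HexVertex) (y z : HexVertex),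
          γ.walk.support = p ++ y :: (s ++ z :: q) ∧ γ'.walk.support = p ++ y :: (s' ++ z :: q) ∧
            s ≠ s' ∧ s.length + s'.length = 4)
        then min 1 (SAW.hexCriticalFugacity ^ ((γ'.length : ℤ) - (γ.length : ℤ))) * (g γ' - g γ) else 0);
  ∀ (D : DobrushinDomain) (a' b' : ℝ → HexVertex) (c : ℝ) (G : CurveClass ℂ → ℝ),
    (∃ f' : ∀ δ : ℝ, SAW.HexDomainSAW D.carrier δ (a' δ) (b' δ) → ℝ,
      Tendsto (fun δ : ℝ => ∫ γ, |c * δ ^ (-(8 : ℝ) / 3) *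
          hexGen D.carrier δ (a' δ) (b' δ) (f' δ) γ - G γ.curve| ∂(SAW.hexSAWLaw D.carrier δ (a' δ) (b' δ)))
        (𝓝[>] (0 : ℝ)) (𝓝 0)) →
    Tendsto (fun δ : ℝ => ∫ γ, G γ.curve ∂(SAW.hexSAWLaw D.carrier δ (a' δ) (b' δ))) (𝓝[>] (0 : ℝ)) (𝓝 0)

/-! ### The stubs (the ONLY `sorry`s of this file; tree vocabulary only, statements written out) -/

/-- **S1 — `stub_hexGeneratorUniversality`** (OPEN, conjecture-grade; the load-bearing stub). The statement
`HexGeneratorUniversality` written out over tree vocabulary (`SAW.bfacfGenerator`, `SAW.law`, `SAW.hexSAWLaw`,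
`SAW.IsEmbEndpointApprox hexGraph hexCenter`, the hexagon-flip generator as an inline `finsum`). Non-vacuity: the
trivial pair `(F, G) = (0, 0)` (correctors `0`) is a `ℤ²` pair in every domain, so S1 in particular asserts that every
Dobrushin domain with a `ℤ²` endpoint approximation carries SOME honeycomb endpoint approximation (true: shadow an
accessibility arc of each marked prime end inside the giant component of `Ω_δ ⊆ δℍ`; technical but standard) — the
content is the transfer of NON-trivial pairs with one universal `c > 0`. Cheapest falsifier: numerics — integrated
autocorrelation time of a smooth signed-area functional under the fixed-endpoint hexagon-flip chain at
`x_c = 1/√(2+√2)` must scale as (mesh)^(-8/3) like BFACF on `ℤ²` (MadrasSlade1993 (9.6.11), doi:10.1007/bf01029987);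
a different dynamic exponent on `ℍ` kills the scalar-`c` form of S1 (repair: a lattice-dependent exponent). -/
theorem stub_hexGeneratorUniversality :
    let hexGen : ∀ (Ω : Set ℂ) (δ : ℝ) (u v : HexVertex), (SAW.HexDomainSAW Ω δ u v → ℝ) →
        SAW.HexDomainSAW Ω δ u v → ℝ := fun Ω δ u v g γ =>
      ∑ᶠ γ' : SAW.HexDomainSAW Ω δ u v,
        (if (∃ (p q s s' : List HexVertex) (y z : HexVertex),
            γ.walk.support = p ++ y :: (s ++ z :: q) ∧ γ'.walk.support = p ++ y :: (s' ++ z :: q) ∧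
              s ≠ s' ∧ s.length + s'.length = 4)
          then min 1 (SAW.hexCriticalFugacity ^ ((γ'.length : ℤ) - (γ.length : ℤ))) * (g γ' - g γ) else 0);
    ∃ c : ℝ, 0 < c ∧ ∀ (D : DobrushinDomain) (a b : ℝ → Site 2), SAW.IsEndpointApprox D a b →
      ∀ F G : CurveClass ℂ → ℝ, Continuous G → (∃ C : ℝ, ∀ x, |G x| ≤ C) →
      (∃ f : ∀ δ : ℝ, SAW.DomainSAW D.carrier δ (a δ) (b δ) → ℝ,
        (∀ ε : ℝ, 0 < ε → ∀ᶠ δ in 𝓝[>] (0 : ℝ),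
          ∀ γ : SAW.DomainSAW D.carrier δ (a δ) (b δ), |f δ γ - F γ.curve| ≤ ε) ∧
        Tendsto (fun δ : ℝ => ∫ γ, |δ ^ (-(8 : ℝ) / 3) *
            SAW.bfacfGenerator SAW.criticalFugacity (f δ) γ - G γ.curve| ∂(SAW.law D.carrier δ (a δ) (b δ)))
          (𝓝[>] (0 : ℝ)) (𝓝 0)) →
      ∃ (a' b' : ℝ → HexVertex), SAW.IsEmbEndpointApprox hexGraph hexCenter D a' b' ∧
        ∃ f' : ∀ δ : ℝ, SAW.HexDomainSAW D.carrier δ (a' δ) (b' δ) → ℝ,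
          (∀ ε : ℝ, 0 < ε → ∀ᶠ δ in 𝓝[>] (0 : ℝ),
            ∀ γ : SAW.HexDomainSAW D.carrier δ (a' δ) (b' δ), |f' δ γ - F γ.curve| ≤ ε) ∧
          Tendsto (fun δ : ℝ => ∫ γ, |c * δ ^ (-(8 : ℝ) / 3) *
              hexGen D.carrier δ (a' δ) (b' δ) (f' δ) γ - G γ.curve| ∂(SAW.hexSAWLaw D.carrier δ (a' δ) (b' δ)))
            (𝓝[>] (0 : ℝ)) (𝓝 0) := by
  sorry

/-- **S2 — `stub_hexStationaryNull`** (PROVABLE NOW, size M). The statement `HexStationaryNull` written out. Route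
to a proof: for `δ > 0` the type `SAW.HexDomainSAW D.carrier δ u v` is finite (vertices `δ·hexCenter v ∈ Ω`, `Ω`
bounded; paths in a finite vertex set) — register a local `Fintype`; `hexSAWLaw = Z⁻¹ • Σ_γ x_c^{ℓ(γ)} δ_γ` with
`Z < ∞`, and `Z = 0` only for the empty type (then the law is `0` and both integrals vanish); exact stationarity
`∫ hexGen g d(hexSAWLaw) = 0`: write the double sum `Σ_γ Σ_γ' x_c^{ℓ(γ)} min(1, x_c^{|γ'|−|γ|}) (g γ' − g γ)`, use the
symmetric kernel `x_c · min(x_c^{|γ|}, x_c^{|γ'|})` (the identity `SAW.bfacf_detailedBalance` verbatim with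
`hexCriticalFugacity`, `SAW.hexCriticalFugacity_pos_lt_one`) and the symmetry of the window relation (swap `s, s'`),
then `Finset.sum_comm`; finally `|∫ G∘curve dP_δ| = |∫ (G∘curve − c δ^(-8/3) hexGen f'_δ) dP_δ| ≤ ∫ |…| dP_δ → 0`
(`integral_sub`, `abs_integral_le_integral_abs`, `squeeze_zero'` along `𝓝[>] 0`, all functions integrable on a finite
type with a finite measure). The `ℤ²` twin of this stub is the pair of route supports ExactStationarity (stmt-7766) +
LimitPointsAnnihilated (stmt-7767). -/
theorem stub_hexStationaryNull :
    let hexGen : ∀ (Ω : Set ℂ) (δ : ℝ) (u v : HexVertex), (SAW.HexDomainSAW Ω δ u v → ℝ) →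
        SAW.HexDomainSAW Ω δ u v → ℝ := fun Ω δ u v g γ =>
      ∑ᶠ γ' : SAW.HexDomainSAW Ω δ u v,
        (if (∃ (p q s s' : List HexVertex) (y z : HexVertex),
            γ.walk.support = p ++ y :: (s ++ z :: q) ∧ γ'.walk.support = p ++ y :: (s' ++ z :: q) ∧
              s ≠ s' ∧ s.length + s'.length = 4)
          then min 1 (SAW.hexCriticalFugacity ^ ((γ'.length : ℤ) - (γ.length : ℤ))) * (g γ' - g γ) else 0);
    ∀ (D : DobrushinDomain) (a' b' : ℝ → HexVertex) (c : ℝ) (G : CurveClass ℂ → ℝ),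
      (∃ f' : ∀ δ : ℝ, SAW.HexDomainSAW D.carrier δ (a' δ) (b' δ) → ℝ,
        Tendsto (fun δ : ℝ => ∫ γ, |c * δ ^ (-(8 : ℝ) / 3) *
            hexGen D.carrier δ (a' δ) (b' δ) (f' δ) γ - G γ.curve| ∂(SAW.hexSAWLaw D.carrier δ (a' δ) (b' δ)))
          (𝓝[>] (0 : ℝ)) (𝓝 0)) →
      Tendsto (fun δ : ℝ => ∫ γ, G γ.curve ∂(SAW.hexSAWLaw D.carrier δ (a' δ) (b' δ)))
        (𝓝[>] (0 : ℝ)) (𝓝 0) := by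
  sorry

/-! ### Consistency: each named statement IS its registered stub (definitionally) -/

theorem hexGeneratorUniversality_holds : HexGeneratorUniversality := stub_hexGeneratorUniversality
theorem hexStationaryNull_holds : HexStationaryNull := stub_hexStationaryNull

/-! ### Name-keyed aliases of the statements — the hypotheses of `SLEAnnihilated_of` -/
namespace __Registered

/-- Alias of `HexGeneratorUniversality` keyed by the registered stub name. -/
abbrev stub_hexGeneratorUniversality : Prop := HexGeneratorUniversality
/-- Alias of `HexStationaryNull` keyed by the registered stub name. -/
abbrev stub_hexStationaryNull : Prop := HexStationaryNull

end __Registered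

/-! ### The skeleton theorem: the two stubs and DCS Conjecture 1 (by name) imply the crux, BY NAME -/

/-- **`SLEAnnihilated` from the line `birth`** (kernel-checked, no `sorry` of its own). Given a `ℤ²` graph-limit pair
`(F, G)` (the crux's inlined BFACF generator is definitionally `SAW.bfacfGenerator SAW.criticalFugacity`), S1 supplies
a honeycomb endpoint approximation `(a', b')` and hex correctors making `(F, G)` a `c·δ^(-8/3)` hexagon-flip pair; S2
turns hex exact stationarity into `E^hex_δ[G ∘ curve] → 0`; DCS Conjecture 1 (hypothesis `hH`, by name) gives an
SLE(8/3) random curve `Γ` with `TendstoLaw` of the hex curves, evaluated at `G` as a `BoundedContinuousFunction`;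
the two limits along the proper filter `𝓝[>] 0` coincide (`tendsto_nhds_unique`), so `∫ G ∘ Γ = 0`; uniqueness of the
SLE(8/3) law (`IsSLELaw.unique'`) and `integral_map` transport this to the arbitrary SLE(8/3) law `μ`. -/
theorem SLEAnnihilated_of (hU : __Registered.stub_hexGeneratorUniversality)
    (hN : __Registered.stub_hexStationaryNull) (hH : SAW.HexSAWScalingLimit) :
    Summit.CriticalPhenomena.SAWScalingLimit.Theses.SAWStochasticQuantisation.SLEAnnihilated := by
  intro D a b happ F G hGc hGb hmem μ hμ
  -- S1: transfer the ℤ² graph-limit pair to a hexagon-flip graph-limit pair along a hex approximation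
  obtain ⟨c, hc, hU'⟩ := hU
  obtain ⟨a', b', happ', f', -, hf'⟩ := hU' D a b happ F G hGc hGb hmem
  -- S2: exact stationarity of the critical honeycomb law makes `G` hex-null
  have hnull : Tendsto (fun δ : ℝ => ∫ γ, G γ.curve ∂(SAW.hexSAWLaw D.carrier δ (a' δ) (b' δ)))
      (𝓝[>] (0 : ℝ)) (𝓝 0) := hN D a' b' c G ⟨f', hf'⟩
  -- S3: the honeycomb SAW converges in law to an SLE(8/3) random curve `Γ`
  obtain ⟨Γ, hΓ, -, hT⟩ := hH D a' b' happ'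
  obtain ⟨C, hC⟩ := hGb
  let Gb : BoundedContinuousFunction (CurveClass ℂ) ℝ :=
    BoundedContinuousFunction.ofNormedAddCommGroup G hGc C (fun x => by simpa [Real.norm_eq_abs] using hC x)
  have hT' : Tendsto (fun δ : ℝ => ∫ γ, G γ.curve ∂(SAW.hexSAWLaw D.carrier δ (a' δ) (b' δ)))
      (𝓝[>] (0 : ℝ)) (𝓝 (∫ ω, G (Γ ω) ∂Process.preWienerMeasure)) := hT Gb
  -- uniqueness of limits along the proper filter `𝓝[>] 0`
  have hlim : ∫ ω, G (Γ ω) ∂Process.preWienerMeasure = 0 := tendsto_nhds_unique hT' hnull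
  -- the SLE(8/3) law is unique: `μ` is the law of `Γ`
  have hμeq : μ = Process.preWienerMeasure.map Γ := IsSLELaw.unique' hμ hΓ.isSLELaw_map
  rw [hμeq, integral_map hΓ.aemeasurable hGc.aestronglyMeasurable]
  exact hlim

/-- Wiring check (an `example`, so that `SLEAnnihilated_of` stays the only theorem concluding the crux): the
registered stubs feed the skeleton theorem as stated. -/
example (hH : SAW.HexSAWScalingLimit) :
    Summit.CriticalPhenomena.SAWScalingLimit.Theses.SAWStochasticQuantisation.SLEAnnihilated :=
  SLEAnnihilated_of stub_hexGeneratorUniversality stub_hexStationaryNull hH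

end Summit.CriticalPhenomena.SAWScalingLimit.Cruxes.SLEAnnihilated.Birth

end
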